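import Summits.Schanuel.Schanuel.Theorems.RootDecomp1EWallDichotomy03

/-!
# RootDecomp1EWallDichotomy — lens 2, generation 40 «(c⁗) WALL DICHOTOMY: TWISTED vs UNTWISTED 1-fold SCALES» (BOOKKEEPING node per RULING L1949: wall-text correction + cross-route instance; the twisted side = tree-corollary of lens 4's frame engine, VARIANT-REACH, no cell credit; member z⋄ = zTwin 2 i (√2·λ_H) with a FINITE-irrationality-exponent certificate) — continuation (RootDecomp1EWallDichotomy04): §5 SEPARATION by tree names + §6 the cells on the class and the items AT `zDia` (LIVE decls)

(lens-2 g40 `WallDichotomy.lean` [HOME/decomp-schanuel-lens-2/g40/ sha256 beadd3d7…, 1177 l; NODE L1955 / REQUEST L1956; critic VERDICT L1964 (bookkeeping, no credit, port GO low)]; port by census-1 gen 17 as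
`RootDecomp1EWallDichotomy01`–`04` — see the PORT NOTE of part 01; `--supports stmt-Schanuel-31409`; bookkeeping node, no credit; rung 0.)
-/

noncomputable section

open Complex IntermediateField

open Summit.Schanuel.Schanuel.Theorems.RootDecomp1KHyper.HyperCell (HyperLiouville hexp hexp_succ hexp_lt_succ
  one_le_hexp succ_le_hexp lambdaH summable_lambdaH hyperLiouville_lambdaH)
open Summit.Schanuel.Schanuel.Theorems.RootDecomp1BHyperFrame (FrameMeasure frameMeasure_of_roy
  algebraicIndependent_cons_of_frameMeasure trdeg_adjoin_le_of_isAlgebraic' hyperFrame polarVec polarExpo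
  polarDeg_hyperFrame_ge)
open Summit.Schanuel.Schanuel.Theorems.RootDecomp1BFedFlagCore (polarDeg)
open Summit.Schanuel.Schanuel.Theorems.RootDecomp1EPointTransfer (Roy2014_thm_1_1 InPointClass lambdaH_convergent)
open Summit.Schanuel.Schanuel.Theorems.RootDecomp1ELWTransport (zTwin zTwin_left zTwin_right linearIndependent_zTwin
  dblMoments InLWClass DyadicHyper₂)
open Summit.Schanuel.Schanuel.Theorems.RootDecomp1ETwoScale (CoveredTower InTwoScaleClass)
open Summit.Schanuel.Schanuel.Theorems.RootDecomp1EScaleTransfer (InScaleClass HyperScaleApprox)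

namespace Summit.Schanuel.Schanuel.Theorems.RootDecomp1EWallDichotomy

/-! ## §5  SEPARATION (hypothesis-free): `z⋄` lies in NONE of the four decided 1E classes -/

/-- `z⋄₀ ≠ 0`. -/
private theorem Tdia_ne_zero_complex : (Tdia : ℂ) ≠ 0 := Complex.ofReal_ne_zero.mpr Tdia_pos.ne'

/-- If `z⋄ = ξ · y` coordinatewise on the first two coordinates then `T⋄ · y₀ = y₁`. -/
private theorem Tdia_mul_eq_of_scale {ξ y0 y1 : ℂ} (e0 : (Tdia : ℂ) = ξ * y0) (e1 : (Tdia : ℂ) ^ 2 = ξ * y1) :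
    (Tdia : ℂ) * y0 = y1 := by
  have hξ : ξ ≠ 0 := by intro h; rw [h, zero_mul] at e0; exact Tdia_ne_zero_complex e0
  refine mul_left_cancel₀ hξ ?_
  calc ξ * ((Tdia : ℂ) * y0) = (Tdia : ℂ) * (ξ * y0) := by ring
    _ = (Tdia : ℂ) ^ 2 := by rw [← e0, sq]
    _ = ξ * y1 := e1

/-- **`z⋄ ∉ InPointClass`** (g36's class `ρ·ℚ̄ⁿ`, `ρ` hyper-Liouville): `z⋄₁/z⋄₀ = T⋄` would be algebraic. -/
theorem not_inPointClass_zDia : ¬ InPointClass zDia := by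
  rintro ⟨ρ, y, -, hyalg, -, hz⟩
  obtain ⟨h0, h1, -, -⟩ := zDia_apply
  have e0 : (Tdia : ℂ) = (ρ : ℂ) * y (Fin.castAdd 2 0) := by rw [← h0, hz]
  have e1 : (Tdia : ℂ) ^ 2 = (ρ : ℂ) * y (Fin.castAdd 2 1) := by rw [← h1, hz]
  have key := Tdia_mul_eq_of_scale e0 e1
  have hy0 : y (Fin.castAdd 2 0) ≠ 0 := by
    intro h; rw [h, mul_zero] at e0; exact Tdia_ne_zero_complex e0
  have eT : (Tdia : ℂ) = y (Fin.castAdd 2 1) * (y (Fin.castAdd 2 0))⁻¹ := by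
    rw [← key, mul_inv_cancel_right₀ hy0]
  exact Tdia_transcendental (by rw [eT]; exact (hyalg _).mul (hyalg _).inv)

/-- **`z⋄ ∉ InScaleClass`** (g35's class `ξ·y`, `ξ` hyper-approximable through an order lattice): at level
`m = 0` the tuple `γ·y` is algebraic, so again `z⋄₁/z⋄₀ = T⋄` would be algebraic. -/
theorem not_inScaleClass_zDia : ¬ InScaleClass zDia := by
  rintro ⟨D, ω, y, ξ, hωalg, -, hξ, hz⟩
  obtain ⟨γ, M, hγ, hγy, -⟩ := hξ 0
  have halg : ∀ j, IsAlgebraic ℚ (γ * y j) := by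
    intro j
    rw [hγy j]
    refine IsIntegral.isAlgebraic (IsIntegral.sum _ fun i _ => ?_)
    exact ((isAlgebraic_int (M i j)).isIntegral).mul (hωalg i).isIntegral
  obtain ⟨h0, h1, -, -⟩ := zDia_apply
  have e0 : (Tdia : ℂ) = ξ * y (Fin.castAdd 2 0) := by rw [← h0, hz]
  have e1 : (Tdia : ℂ) ^ 2 = ξ * y (Fin.castAdd 2 1) := by rw [← h1, hz]
  have key := Tdia_mul_eq_of_scale e0 e1
  have hy0 : γ * y (Fin.castAdd 2 0) ≠ 0 := by
    refine mul_ne_zero hγ ?_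
    intro h; rw [h, mul_zero] at e0; exact Tdia_ne_zero_complex e0
  have eT : (Tdia : ℂ) = (γ * y (Fin.castAdd 2 1)) * (γ * y (Fin.castAdd 2 0))⁻¹ := by
    rw [← key, show γ * ((Tdia : ℂ) * y (Fin.castAdd 2 0)) = (Tdia : ℂ) * (γ * y (Fin.castAdd 2 0)) by ring,
      mul_inv_cancel_right₀ hy0]
  exact Tdia_transcendental (by rw [eT]; exact (halg _).mul (halg _).inv)

/-- `exp 5 < 200`. -/
private theorem exp_five_lt : Real.exp 5 < 200 := by
  have h1 : Real.exp 1 < 2.7182818286 := Real.exp_one_lt_d9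
  have h0 : 0 < Real.exp 1 := Real.exp_pos 1
  have e : Real.exp 5 = Real.exp 1 ^ 5 := by rw [Real.exp_one_pow 5]; norm_num
  rw [e]
  calc Real.exp 1 ^ 5 < (2.7182818286 : ℝ) ^ 5 := pow_lt_pow_left₀ h1 h0.le (by norm_num)
    _ < 200 := by norm_num

/-- **`T⋄` carries NO covered tower** (g37's scale class): a tower would give `|T⋄ − r| ≤ exp(−log³ den r)`
with `den r → ∞`, against `|T⋄ − r| ≥ 2^{−50} den(r)^{−10}`. -/
theorem not_coveredTower_Tdia : ¬ CoveredTower Tdia := by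
  rintro ⟨N₀, hN⟩
  obtain ⟨r, hX, -, hr⟩ := hN (max N₀ 200) (le_max_left _ _)
  have hden : (200 : ℝ) ≤ r.den := by exact_mod_cast (le_max_right N₀ 200).trans hX
  have hd0 : (0 : ℝ) < r.den := by linarith
  have hlow := (Tdia_sub_rat_lower r).trans hr
  -- take logarithms: `−(50 log 2 + 10 log den) ≤ −(log den)³`
  have hlog := Real.log_le_log (by positivity) hlow
  rw [Real.log_exp, one_div, Real.log_inv, Real.log_mul (by positivity) (by positivity), Real.log_pow,
    Real.log_pow] at hlog
  set u := Real.log (r.den : ℝ) with hu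
  have hu5 : 5 ≤ u := by
    rw [hu, Real.le_log_iff_exp_le hd0]
    linarith [exp_five_lt]
  have hl2 : Real.log 2 < 0.6931471808 := Real.log_two_lt_d9
  push_cast at hlog
  nlinarith [hlog, hu5, hl2, mul_le_mul_of_nonneg_left hu5 (by linarith : (0 : ℝ) ≤ u),
    mul_le_mul (le_refl u) (mul_le_mul_of_nonneg_left hu5 (by linarith : (0 : ℝ) ≤ u)) (by nlinarith)
      (by linarith)]

/-- **`z⋄ ∉ InTwoScaleClass`** (g37): its first coordinate would carry a covered tower. -/
theorem not_inTwoScaleClass_zDia : ¬ InTwoScaleClass zDia := by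
  rintro ⟨T, σ, β, hCT, -, -, -, -, hz⟩
  obtain ⟨h0, -, -, -⟩ := zDia_apply
  have e0 : (Tdia : ℂ) = (T : ℂ) := by
    rw [← h0, hz]; rfl
  have eT : Tdia = T := Complex.ofReal_injective e0
  exact not_coveredTower_Tdia (eT ▸ hCT)

/-- `|a^{n+1} − b^{n+1}| ≤ (n+1) · M^n · |a − b|` for `|a|, |b| ≤ M`. -/
private theorem abs_pow_succ_sub_le {a b M : ℝ} (ha : |a| ≤ M) (hb : |b| ≤ M) (n : ℕ) :
    |a ^ (n + 1) - b ^ (n + 1)| ≤ ((n : ℝ) + 1) * M ^ n * |a - b| := by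
  have hM : 0 ≤ M := (abs_nonneg a).trans ha
  induction n with
  | zero => simp
  | succ n ih =>
      have e : a ^ (n + 1 + 1) - b ^ (n + 1 + 1) = a * (a ^ (n + 1) - b ^ (n + 1)) + (a - b) * b ^ (n + 1) := by
        ring
      have h1 : |a| * |a ^ (n + 1) - b ^ (n + 1)| ≤ M * (((n : ℝ) + 1) * M ^ n * |a - b|) :=
        mul_le_mul ha ih (abs_nonneg _) hM
      have h2 : |a - b| * |b| ^ (n + 1) ≤ |a - b| * M ^ (n + 1) :=
        mul_le_mul_of_nonneg_left (pow_le_pow_left₀ (abs_nonneg b) hb (n + 1)) (abs_nonneg _)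
      calc |a ^ (n + 1 + 1) - b ^ (n + 1 + 1)|
          = |a * (a ^ (n + 1) - b ^ (n + 1)) + (a - b) * b ^ (n + 1)| := by rw [e]
        _ ≤ |a * (a ^ (n + 1) - b ^ (n + 1))| + |(a - b) * b ^ (n + 1)| := abs_add_le _ _
        _ = |a| * |a ^ (n + 1) - b ^ (n + 1)| + |a - b| * |b| ^ (n + 1) := by
            rw [abs_mul, abs_mul, abs_pow]
        _ ≤ M * (((n : ℝ) + 1) * M ^ n * |a - b|) + |a - b| * M ^ (n + 1) := add_le_add h1 h2
        _ = (((n + 1 : ℕ) : ℝ) + 1) * M ^ (n + 1) * |a - b| := by push_cast; ring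

/-- `2^x ≤ exp x` for naturals `x`. -/
private theorem two_pow_le_exp (x : ℕ) : (2 : ℝ) ^ x ≤ Real.exp x := by
  have h2 : (2 : ℝ) ≤ Real.exp 1 := by linarith [Real.add_one_le_exp (1 : ℝ)]
  calc (2 : ℝ) ^ x ≤ Real.exp 1 ^ x := pow_le_pow_left₀ (by norm_num) h2 x
    _ = Real.exp x := by rw [← Real.exp_one_pow]

/-- **`T⋄` is not a positive power `T^J` (`J ≥ 1`) of a dyadic 2-fold hyper-Liouville `T`** — the scale
class of g39's `InLWClass`: `|T^J − (p/2^μ)^J| ≤ J (T+1)^{J−1} exp(−exp(2^{mμ}))` against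
`|T⋄ − p^J/2^{μJ}| ≥ 2^{−50} 2^{−10 μ J}`. -/
theorem Tdia_ne_pow_of_dyadicHyper₂ {T : ℝ} (hT2 : DyadicHyper₂ T) (hT0 : 0 < T) (j : ℕ) :
    Tdia ≠ T ^ (j + 1) := by
  intro hTJ
  -- the Lipschitz constant of `x ↦ x^{j+1}` on `|x| ≤ T + 1`
  set Kc : ℝ := ((j : ℝ) + 1) * (T + 1) ^ j with hKc
  have hKc0 : 0 ≤ Kc := by positivity
  -- choose the level
  obtain ⟨m, hm⟩ : ∃ m : ℕ, 50 + Kc + 10 * ((j : ℝ) + 1) + 1 ≤ m := exists_nat_ge _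
  have hm1 : 1 ≤ m := by
    have : (1 : ℝ) ≤ m := by linarith
    exact_mod_cast this
  obtain ⟨μ, p, hμ, -, hlt⟩ := hT2 m
  have hμ1 : (1 : ℝ) ≤ μ := by exact_mod_cast hm1.trans hμ
  have hmR : (m : ℝ) ≤ μ := by exact_mod_cast hμ
  set ε : ℝ := Real.exp (-Real.exp ((2 : ℝ) ^ (m * μ))) with hε
  have hε0 : 0 < ε := Real.exp_pos _
  have hε1 : ε ≤ 1 := by rw [hε, Real.exp_le_one_iff]; exact neg_nonpos.mpr (Real.exp_pos _).le
  -- the power difference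
  have ha : |T| ≤ T + 1 := by rw [abs_of_pos hT0]; linarith
  have hb : |(p : ℝ) / 2 ^ μ| ≤ T + 1 := by
    have := abs_sub_abs_le_abs_sub ((p : ℝ) / 2 ^ μ) T
    rw [abs_sub_comm] at this
    rw [abs_of_pos hT0] at this
    linarith [hlt.le]
  have hpow := abs_pow_succ_sub_le ha hb j
  -- `T^{j+1} = T⋄` and `(p/2^μ)^{j+1} = p^{j+1} / 2^{μ(j+1)}`
  have hq1 : 1 ≤ 2 ^ (μ * (j + 1)) := Nat.one_le_two_pow
  have hmeas := irrationality_measure_Tdia' (p ^ (j + 1) : ℤ) hq1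
  have e1 : (((p : ℕ) ^ (j + 1) : ℤ) : ℝ) / (((2 ^ (μ * (j + 1)) : ℕ) : ℝ)) = ((p : ℝ) / 2 ^ μ) ^ (j + 1) := by
    push_cast; rw [div_pow, ← pow_mul]
  rw [e1, hTJ] at hmeas
  -- combine: `2^{-50} (2^{μ(j+1)})^{-10} ≤ Kc · ε`
  have hchain : 1 / ((2 : ℝ) ^ 50 * (((2 ^ (μ * (j + 1)) : ℕ) : ℝ)) ^ 10) ≤ Kc * ε :=
    hmeas.trans (hpow.trans (by rw [hKc]; exact mul_le_mul_of_nonneg_left hlt.le (by positivity)))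
  -- size of the left side: `2^50 · 2^{10 μ (j+1)} · Kc < exp(exp(2^{mμ})) = 1/ε`
  have hbig : (2 : ℝ) ^ 50 * (((2 ^ (μ * (j + 1)) : ℕ) : ℝ)) ^ 10 * Kc < Real.exp (Real.exp ((2 : ℝ) ^ (m * μ))) := by
    have hA : (2 : ℝ) ^ 50 * (((2 ^ (μ * (j + 1)) : ℕ) : ℝ)) ^ 10 * Kc ≤
        Real.exp ((50 : ℕ) + ((10 * (μ * (j + 1)) : ℕ) : ℝ) + Kc) := by
      rw [Real.exp_add, Real.exp_add]
      refine mul_le_mul (mul_le_mul (two_pow_le_exp 50) ?_ (by positivity) (Real.exp_pos _).le)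
        (by linarith [Real.add_one_le_exp Kc]) hKc0 (by positivity)
      have : (((2 ^ (μ * (j + 1)) : ℕ) : ℝ)) ^ 10 = (2 : ℝ) ^ (10 * (μ * (j + 1))) := by
        push_cast; rw [← pow_mul]; ring_nf
      rw [this]; exact two_pow_le_exp _
    refine lt_of_le_of_lt hA (Real.exp_lt_exp.mpr ?_)
    -- `50 + 10 μ (j+1) + Kc < 2^{mμ} ≤ exp(2^{mμ})`
    have h2pow : (m : ℝ) * μ < (2 : ℝ) ^ (m * μ) := by
      have := Nat.lt_two_pow_self (n := m * μ)
      exact_mod_cast this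
    have hlin : (50 : ℝ) + 10 * (μ * ((j : ℝ) + 1)) + Kc ≤ (m : ℝ) * μ := by
      have := mul_le_mul_of_nonneg_right hm (by linarith : (0 : ℝ) ≤ μ)
      nlinarith [hKc0, hμ1]
    push_cast
    linarith [Real.add_one_le_exp ((2 : ℝ) ^ (m * μ))]
  -- contradiction
  have hprod : 1 ≤ (2 : ℝ) ^ 50 * (((2 ^ (μ * (j + 1)) : ℕ) : ℝ)) ^ 10 * (Kc * ε) := by
    have hpos : (0 : ℝ) < (2 : ℝ) ^ 50 * (((2 ^ (μ * (j + 1)) : ℕ) : ℝ)) ^ 10 := by positivity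
    rw [div_le_iff₀ hpos] at hchain
    linarith
  have hεinv : Real.exp (Real.exp ((2 : ℝ) ^ (m * μ))) * ε = 1 := by
    rw [hε, ← Real.exp_add, add_neg_cancel, Real.exp_zero]
  nlinarith [hbig, hprod, hε0, hεinv, mul_lt_mul_of_pos_right hbig hε0]

/-- **`z⋄ ∉ InLWClass`** (g39's class: coordinates in a doubled moment set `{T^j, βT^j}` of a dyadic 2-fold
hyper-Liouville `T > 0`): the coordinate `iT⋄ ∉ ℝ` forces `β ∉ ℝ`, so `T⋄ = T^J` — excluded above. -/
theorem not_inLWClass_zDia : ¬ InLWClass zDia := by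
  rintro ⟨T, β, k, hT2, hT0, -, -, hsub⟩
  obtain ⟨h0, -, h2, -⟩ := zDia_apply
  obtain ⟨j, hj⟩ := hsub ⟨Fin.natAdd 2 0, rfl⟩
  obtain ⟨j', hj'⟩ := hsub ⟨Fin.castAdd 2 0, rfl⟩
  rw [h2] at hj
  rw [h0] at hj'
  have him : ∀ n : ℕ, ((T : ℂ) ^ n).im = 0 := fun n => by rw [← Complex.ofReal_pow, Complex.ofReal_im]
  have hre : ∀ n : ℕ, ((T : ℂ) ^ n).re = T ^ n := fun n => by rw [← Complex.ofReal_pow, Complex.ofReal_re]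
  rcases hj with hj | hj
  · -- `i T⋄ = T^{j+1}`: imaginary parts give `T⋄ = 0`
    have := congrArg Complex.im hj
    rw [him, Complex.mul_im, Complex.I_re, Complex.I_im, Complex.ofReal_re, Complex.ofReal_im] at this
    simp at this
    exact Tdia_pos.ne' this
  · rcases hj' with hj' | hj'
    · -- `T⋄ = T^{j'+1}`: the excluded case
      have eT : Tdia = T ^ ((j' : ℕ) + 1) := by
        apply Complex.ofReal_injective; rw [hj']; push_cast; rfl
      exact Tdia_ne_pow_of_dyadicHyper₂ hT2 hT0 j' eT
    · -- `T⋄ = β T^{j'+1}` with `β T^{j+1} = i T⋄`: real parts clash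
      have e : (Tdia : ℂ) * (T : ℂ) ^ ((j : ℕ) + 1) = I * (Tdia : ℂ) * (T : ℂ) ^ ((j' : ℕ) + 1) := by
        calc (Tdia : ℂ) * (T : ℂ) ^ ((j : ℕ) + 1) = β * (T : ℂ) ^ ((j' : ℕ) + 1) * (T : ℂ) ^ ((j : ℕ) + 1) := by
              rw [← hj']
          _ = β * (T : ℂ) ^ ((j : ℕ) + 1) * (T : ℂ) ^ ((j' : ℕ) + 1) := by ring
          _ = I * (Tdia : ℂ) * (T : ℂ) ^ ((j' : ℕ) + 1) := by rw [← hj]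
      have := congrArg Complex.re e
      rw [Complex.mul_re, hre, him, Complex.ofReal_re, Complex.ofReal_im, mul_assoc, Complex.mul_re,
        Complex.I_re, Complex.I_im, Complex.mul_im, Complex.ofReal_re, Complex.ofReal_im, hre, him] at this
      simp at this
      rcases this with h | h
      · exact Tdia_pos.ne' h
      · exact hT0.ne' h

/-- **SEPARATION, assembled:** `z⋄` lies in none of the four decided explicit 1E classes (g35 scale class,
g36 point class, g37 two-scale class, g39 LW class), and its scale is neither hyper-Liouville nor Liouville. -/
theorem zDia_separation : ¬ InPointClass zDia ∧ ¬ InScaleClass zDia ∧ ¬ InTwoScaleClass zDia ∧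
    ¬ InLWClass zDia ∧ ¬ HyperLiouville Tdia ∧ ¬ Liouville Tdia :=
  ⟨not_inPointClass_zDia, not_inScaleClass_zDia, not_inTwoScaleClass_zDia, not_inLWClass_zDia,
    not_hyperLiouville_Tdia, not_liouville_Tdia⟩

/-- … while `z⋄` IS in the twisted-frame class (through `ℚ(√2, i)`). -/
theorem zDia_mem_twistedFrameClass : InTwistedFrameClass zDia :=
  zTwin_twisted_mem_class isAlgebraic_sqrt_two_complex isAlgebraic_I linearIndependent_zTwin_two_I_sqrt_two
    hyperLiouville_lambdaH

/-- **(B3) the honest POSITIVE membership, by TREE NAMES:** `z⋄` is lens 4 g32's frame datum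
`(ρ^{e_j} y_j)_j` with `ρ = λ_H ∈ HyperLiouville`, `y = zTwin 2 i √2 = (√2, 2, i√2, 2i)`, `e = (1, 2, 1, 2)` … -/
theorem zDia_eq_frame : zDia = fun j => ((lambdaH : ℝ) : ℂ) ^ (twinExpo 2 j) * zTwin 2 I (Real.sqrt 2) j :=
  zTwin_twist 2 I (Real.sqrt 2) lambdaH

/-- … equivalently the polar vector of lens 4's `hyperFrame (√2, 2) (1, 2) λ_H` … -/
theorem zDia_eq_polarVec_hyperFrame :
    zDia = polarVec (hyperFrame (fun j : Fin 2 => Real.sqrt 2 ^ ((j : ℕ) + 1)) (fun j => (j : ℕ) + 1)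
      lambdaH) :=
  zTwin_I_twist_eq_polarVec_hyperFrame 2 (Real.sqrt 2) lambdaH

/-- … its frame carries lens 4's `FrameMeasure` (from `hRoy`, tree `frameMeasure_of_roy`) … -/
theorem frameMeasure_twin_sqrt_two (hRoy : Roy2014_thm_1_1) : FrameMeasure (zTwin 2 I (Real.sqrt 2)) (twinExpo 2) :=
  frameMeasure_of_roy hRoy (isAlgebraic_zTwin isAlgebraic_sqrt_two_complex isAlgebraic_I 2)
    linearIndependent_zTwin_two_I_sqrt_two (twinExpo 2)

/-- … and lens 4's tree ENGINE `algebraicIndependent_cons_of_frameMeasure` applies to it verbatim: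
`λ_H, e^{z⋄₀}, …, e^{z⋄₃}` are algebraically independent (mod `hRoy`). -/
theorem tree_engine_at_zDia (hRoy : Roy2014_thm_1_1) :
    AlgebraicIndependent ℚ (Fin.cons ((lambdaH : ℝ) : ℂ) (fun j => cexp (zDia j)) : Fin (2 + 2 + 1) → ℂ) := by
  have h := algebraicIndependent_cons_of_frameMeasure (frameMeasure_twin_sqrt_two hRoy) hyperLiouville_lambdaH
  rw [zDia_eq_frame]
  exact h

/-! ## §6  The CELLS of the 1E items on the twisted-frame class, and the items AT `z⋄` (mod `hRoy`) -/

/-- **CELL of item 25020 `DefectOneSchanuel`** — binders verbatim, ONE class line `InTwistedFrameClass z`;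
one line from `S` itself on the class. -/
theorem cell_25020 (hRoy : Roy2014_thm_1_1) : ∀ (n : ℕ) (z : Fin n → ℂ), LinearIndependent ℚ z →
    InTwistedFrameClass z →
      (n : Cardinal) ≤ Algebra.trdeg ℚ
        ↥(IntermediateField.adjoin ℚ (Set.range z ∪ Set.range (Complex.exp ∘ z))) + 1 :=
  fun n z _ hcl => (schanuel_inTwistedFrameClass hRoy n z hcl).trans le_self_add

/-- **CELL of item 31409 `EStableDefectOne`** — binders verbatim (E-stability and the first-failure hypothesis
CARRIED, not consumed), ONE class line `InTwistedFrameClass z`. -/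
theorem cell_31409 (hRoy : Roy2014_thm_1_1) : ∀ (n : ℕ) (z : Fin n → ℂ), LinearIndependent ℚ z →
    (∃ β : ℂ, IsAlgebraic ℚ β ∧ β ∉ Set.range (algebraMap ℚ ℂ) ∧
      ∀ i, β * z i ∈ Submodule.span ℚ (Set.range z)) →
    (∀ (m : ℕ) (w : Fin m → ℂ), m < n → LinearIndependent ℚ w →
      (∀ j, w j ∈ Submodule.span ℚ (Set.range z)) →
        (m : Cardinal) ≤ Algebra.trdeg ℚ
          ↥(IntermediateField.adjoin ℚ (Set.range w ∪ Set.range (Complex.exp ∘ w))) + 1) →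
    InTwistedFrameClass z →
      (n : Cardinal) ≤ Algebra.trdeg ℚ
        ↥(IntermediateField.adjoin ℚ (Set.range z ∪ Set.range (Complex.exp ∘ z))) + 1 :=
  fun n z hli _ _ hcl => cell_25020 hRoy n z hli hcl

/-- **Item 25020 AT `z⋄`** (its body at `n = 4`, `z = z⋄`), proved outright mod `hRoy`. -/
theorem item25020_at_zDia (hRoy : Roy2014_thm_1_1) : LinearIndependent ℚ zDia →
    ((2 + 2 : ℕ) : Cardinal) ≤ Algebra.trdeg ℚ
      ↥(IntermediateField.adjoin ℚ (Set.range zDia ∪ Set.range (Complex.exp ∘ zDia))) + 1 :=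
  fun hli => cell_25020 hRoy (2 + 2) zDia hli zDia_mem_twistedFrameClass

/-- **Item 31409 AT `z⋄`** (its body at `n = 4`, `z = z⋄`: all three binders dischargeable — `z⋄` is ℚ-free
(`linearIndependent_zDia`) and E-stable (`zDia_Estable`)), proved outright mod `hRoy`. -/
theorem item31409_at_zDia (hRoy : Roy2014_thm_1_1) : LinearIndependent ℚ zDia →
    (∃ β : ℂ, IsAlgebraic ℚ β ∧ β ∉ Set.range (algebraMap ℚ ℂ) ∧
      ∀ i, β * zDia i ∈ Submodule.span ℚ (Set.range zDia)) →
    (∀ (m : ℕ) (w : Fin m → ℂ), m < 2 + 2 → LinearIndependent ℚ w →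
      (∀ j, w j ∈ Submodule.span ℚ (Set.range zDia)) →
        (m : Cardinal) ≤ Algebra.trdeg ℚ
          ↥(IntermediateField.adjoin ℚ (Set.range w ∪ Set.range (Complex.exp ∘ w))) + 1) →
    ((2 + 2 : ℕ) : Cardinal) ≤ Algebra.trdeg ℚ
      ↥(IntermediateField.adjoin ℚ (Set.range zDia ∪ Set.range (Complex.exp ∘ zDia))) + 1 :=
  fun hli hE hIH => cell_31409 hRoy (2 + 2) zDia hli hE hIH zDia_mem_twistedFrameClass

section LiveItems

open Summit.Schanuel.Schanuel.Theses.RootDecomp1E (DefectOneSchanuel EStableDefectOne)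

/-- The LIVE item 25020 restricted to the twisted-frame class is exactly what `cell_25020 hRoy` proves. -/
theorem cell_25020_of_defectOneSchanuel (h : DefectOneSchanuel) : ∀ (n : ℕ) (z : Fin n → ℂ),
    LinearIndependent ℚ z → InTwistedFrameClass z →
      (n : Cardinal) ≤ Algebra.trdeg ℚ
        ↥(IntermediateField.adjoin ℚ (Set.range z ∪ Set.range (Complex.exp ∘ z))) + 1 :=
  fun n z hli _ => h n z hli

/-- The LIVE item 31409 specialised at `z⋄` (types against the live decl; `Fin (2+2) = Fin 4` silently): its
linear-independence and E-stability binders are DISCHARGED (`linearIndependent_zDia`, `zDia_Estable`); the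
first-failure binder (= `S⁻` below `4` inside `span_ℚ z⋄`) stays a hypothesis. -/
theorem eStableDefectOne_at_zDia (h : EStableDefectOne) :
    (∀ (m : ℕ) (w : Fin m → ℂ), m < 2 + 2 → LinearIndependent ℚ w →
      (∀ j, w j ∈ Submodule.span ℚ (Set.range zDia)) →
        (m : Cardinal) ≤ Algebra.trdeg ℚ
          ↥(IntermediateField.adjoin ℚ (Set.range w ∪ Set.range (Complex.exp ∘ w))) + 1) →
    ((2 + 2 : ℕ) : Cardinal) ≤ Algebra.trdeg ℚ
      ↥(IntermediateField.adjoin ℚ (Set.range zDia ∪ Set.range (Complex.exp ∘ zDia))) + 1 :=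
  h (2 + 2) zDia linearIndependent_zDia zDia_Estable

end LiveItems

end Summit.Schanuel.Schanuel.Theorems.RootDecomp1EWallDichotomy
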